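/-
COR-CM (cell pub-hodgecm2 = stage 2 of the Hodge ladder), seat b08 gen 9 (prover-pub-hodgecm2-b08-g9-0, 2026-08-20),
LIT-FANOUT row D5 (d′) route (β): the displayed binder `h₃ = PicardCM.CMAbelianVarietyRealised` of the `E` term from
Riemann's FULLNESS record `hR` ALONE, and the `E` term with the TOP leaves `h₁`, `hR`, `PerLFace` only.
Theorems only: no definition, no named fact, no instance.
-/
import Summits.HodgeConjecture.CorCM.Geometry.RiemannEssentialImage
import Summits.HodgeConjecture.CorCM.Assembly.ModelChain
import Literature.AlgebraicGeometry.ComplexMultiplication.CMAbelianVarietyRealisedOfRiemann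
import Literature.AlgebraicGeometry.HodgeTheory.ComplexConjugationHolds
import Literature.AlgebraicGeometry.HodgeTheory.HodgeFiltrationModelsReductionProofs
import HarnessLib

/-!
# COR-CM — the model chain with `h₃` discharged: `HC_CM` from `h₁`, `hR` and `PerLFace`

The stage-2 `E` term of record `hc_cm_of_PerLFace : HC_CM_of_PerLFace` (`CorCM/Assembly/ModelChain.lean`) displays
the TOP data `hHD`, `hI`, `h₁ : BallQuotientUniformised`, `h₃ : CMAbelianVarietyRealised`, stage 1's cited record
`hR : DeligneMilne1982_Thm_6_20_full` and the face-form period theorem of the model universe.  Of these, `hHD` and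
`hI` are tree theorems (`exists_isReal_hodgeModel_holds`, `hodgePQ_independent_of_hodgeModel_holds`), and `h₃` is a
theorem modulo the two clauses of Riemann's theorem (Deligne–Milne 1982, Thm. 6.20):
`ComplexMultiplication.cmAbelianVarietyRealised_of_riemann (hR) (hE)`
(`Literature/AlgebraicGeometry/ComplexMultiplication/CMAbelianVarietyRealisedOfRiemann.lean`, cell seat b18) — CM abelian
varieties of every CM type exist as abelian varieties with the CM type read on `H¹` (Shimura 1998 §6.2 Thm. 3).  The
essential-image clause `hE` is now PROVED (`deligneMilne1982_Thm_6_20_essImage_holds`,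
`CorCM/Geometry/RiemannEssentialImage.lean`), so:

* `cmAbelianVarietyRealised_of_full (hR) : CMAbelianVarietyRealised` — the binder `h₃` from the fullness record ALONE;
* `hc_cm_of_PerLFace_of_full (h₁) (hR) (hP) : HC_CM` — the `E` term of record instantiated at `hHD := …_holds`,
  `hI := …_holds`, `h₃ := cmAbelianVarietyRealised_of_full hR`: the Hodge conjecture for complex abelian varieties of CM
  type (`HC_CM`, BY NAME) from the uniformisation datum `h₁`, Deligne–Milne 1982 Thm. 6.20 (fullness) `hR`, and the
  face-form period theorem `PerLFace` of THAT model universe — three displayed leaves instead of five.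

Nothing is asserted; no new constant of type `HC_CM_of_PerLFace` (RULING E-DEDUP of the cell).

## References

* [DeligneMilne1982Tannakian] P. Deligne, J. S. Milne, *Tannakian Categories*, LNM 900 (1982), §6 Thm. 6.20 (Riemann), p. 212.
* [Shimura1998] G. Shimura, *Abelian Varieties with Complex Multiplication and Modular Functions* (1998), §6.2 Thm. 3.
-/

noncomputable section

namespace Summit.HodgeConjecture.CorCM

open Literature.NumberTheory.Automorphic.PicardCM
open Literature.AlgebraicGeometry.HodgeTheory
open Literature.AlgebraicGeometry.ComplexMultiplication (cmAbelianVarietyRealised_of_riemann)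

/-- **The displayed binder `h₃` from Riemann's fullness record alone**: CM abelian varieties of every CM type exist,
as abelian varieties `(A, ι : 𝓞_K → End A)` with the CM type read on `H¹` (`PicardCM.CMAbelianVarietyRealised`,
Shimura 1998 §6.2 Thm. 3), given Deligne–Milne 1982 Thm. 6.20 (fullness) — b18's
`cmAbelianVarietyRealised_of_riemann` with its essential-image hypothesis discharged by
`deligneMilne1982_Thm_6_20_essImage_holds`. [cite: Shimura1998, §6.2 Theorem 3 (pp. 41–42)]
[cite: DeligneMilne1982Tannakian, §6 Thm. 6.20 (Riemann), p. 212] -/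
theorem cmAbelianVarietyRealised_of_full (hR : DeligneMilne1982_Thm_6_20_full) : CMAbelianVarietyRealised :=
  cmAbelianVarietyRealised_of_riemann hR deligneMilne1982_Thm_6_20_essImage_holds

/-- **The stage-2 `E` term with three displayed leaves**: for the Picard–CM model universe of record built on the
tree's `hHD`, `hI` and on `h₃ := cmAbelianVarietyRealised_of_full hR`, the uniformisation datum `h₁`, Deligne–Milne
1982 Thm. 6.20 (fullness) `hR` and the face-form period theorem of that universe imply the Hodge conjecture for every
complex abelian variety of CM type — `HC_CM = Theses.RankFourFaces.CMAbelianHodge`, BY NAME — by the `E` term of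
record `hc_cm_of_PerLFace`. [cite: DeligneMilne1982Tannakian, §6 Thm. 6.20 (Riemann), p. 212] -/
theorem hc_cm_of_PerLFace_of_full (h₁ : BallQuotientUniformised) (hR : DeligneMilne1982_Thm_6_20_full)
    (hP : (Model.picardCMUniverse exists_isReal_hodgeModel_holds hodgePQ_independent_of_hodgeModel_holds h₁
      (cmAbelianVarietyRealised_of_full hR)).PerLFace) :
    HC_CM :=
  hc_cm_of_PerLFace exists_isReal_hodgeModel_holds hodgePQ_independent_of_hodgeModel_holds h₁
    (cmAbelianVarietyRealised_of_full hR) hP hR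

end Summit.HodgeConjecture.CorCM

end
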